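import Summits.QuantumFields.Balaban3D.Carriers.Run
import Summits.QuantumFields.Balaban3D.Proofs.Terminal3
import Literature.MathematicalPhysics.QuantumFieldTheory.Balaban1983to89.B10Eq6DensityLevel

/-!
# Bałaban CMP 102 (1985), d = 3 lane — `Proofs.Run3Terminal`: the ε-uniform bounds on `Z^ε` of **(6)** p. 257 FOR THE CONSTRUCTED
# RUN `Carriers.run3` (identity (6) and integrability discharged by the carrier seat), from (5)_K / (3)

Source: T. Bałaban, CMP **102** (1985) 255–275 [Balaban1985UV3], (6) p. 257 = PDF 3 L11–14 «The bounds (5) imply bounds for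
partition functions, i.e. for the integrals ∫dUρ_k(U), hence by normalization identities ∫dUρ_k = ∫dUT^kρ₀ = ∫dUρ₀ = Z^ε, (6)
they imply uniform in ε bounds for the partition function Z^ε.»  Lane `pub-balaban3d`, seat p3 (PLAN §3.1 «(6)/(3) for run3»).

WHAT THIS FILE PROVES: `Proofs.Terminal3.Zeps_le_of_bounds5At` / `Zeps_ge_of_bounds3` with their two carrier hypotheses —
the identity (6) `RunObjects.Eq6` and the integrability of `ρ_K` — DISCHARGED by the carrier seat's `Carriers.run3_eq6`,
`Carriers.run3_rho_integrable` (D-1a/D-1c: `T = rtOpIOfAC`, Radon–Nikodym transport); what remains hypothetical is exactly the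
paper's bound ((5) at k = K, resp. (3)) and, for the lower side, the Haar window `{|g − 1| < δ}` (measurable for a
`RegularGaugeGroup`; of positive volume for U(N)/SU(N): `B10Eq6DensityLevel.haar_dist1Lt_pos_unitaryGroup` /
`…_specialUnitaryGroup`).  HONEST FRAMING (PLAN §0): bookkeeping over the constructed carriers; nothing of (5)/(3) is asserted.
-/

namespace Summit.QuantumFields.Balaban3D.Proofs.Run3Terminal

open _root_.MeasureTheory
open Literature.MathematicalPhysics.QuantumFieldTheory.Balaban1983to89
open Literature.MathematicalPhysics.QuantumFieldTheory.Balaban1985CMP102.Setting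
open Summit.QuantumFields.Balaban3D.Carriers
open Summit.QuantumFields.Balaban3D.Proofs.ScalesArithmetic
open Summit.QuantumFields.Balaban3D.Proofs.Terminal3

variable {L : ℕ} {S : Scales L} {G : Type} [GaugeGroup G] [MeasurableSpace G] [HaarData G]

/-- **`Z^ε ≤ exp(O1·ε₀⁻³|T_ε|)` for the constructed run** from (5) at `k = K` — (6) discharged by `Carriers.run3_eq6`.
[cite: Balaban1985UV3, (6) p.257] -/
theorem run3_Zeps_le [RegularGaugeGroup G] (I : RunInput S G) {O1 : ℝ}
    (h5 : B10.Bounds5At (run3 I).toRunData O1 S.K) :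
    (run3 I).Zeps ≤ Real.exp (O1 * (S.ε₀⁻¹ ^ 3 * S.volT)) :=
  Zeps_le_of_bounds5At (run3 I) (run3_eq6 I) h5

/-- **`e^{−O1|T_ε|}·m(δ)^{3ε₀⁻³|T_ε|} ≤ Z^ε` for the constructed run** from (3) — (6) and the integrability of `ρ_K` discharged by
`Carriers.run3_eq6`, `Carriers.run3_rho_integrable`; `4δ ≤ ε₁(K)`, `m(δ) = haar{|g − 1| < δ}` (window measurable:
`B10Eq6DensityLevel.measurableSet_dist1Lt`), exponent `#bonds(T₁^{(K)}) = 3ε₀⁻³|T_ε|` (`Terminal3.card_pbond_K_eq`): UNIFORM IN ε.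
[cite: Balaban1985UV3, (6) p.257] -/
theorem run3_Zeps_ge [RegularGaugeGroup G] (I : RunInput S G) {O1 : ℝ} (h3 : (run3 I).Bounds3 O1)
    {δ : ℝ} (h4 : 4 * δ ≤ I.ε₁ S.K) :
    Real.exp (-(O1 * S.volT)) * (((HaarData.haar : Measure G) {g : G | dist1 g < δ}).toReal)
        ^ Fintype.card (PBond S.P S.K) ≤ (run3 I).Zeps :=
  Zeps_ge_of_bounds3 (run3 I) (run3_eq6 I) (run3_rho_integrable I S.K) h3 h4
    (B10Eq6DensityLevel.measurableSet_dist1Lt δ)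

/-- Both sides from (5)_K and the regularity input of (3) ⇐ (5) (`Terminal3.bounds3_of_bounds5At`), for the constructed run:
`e^{−c_low|T_ε|}·m(δ)^{3ε₀⁻³|T_ε|} ≤ Z^ε ≤ e^{c_up|T_ε|}` with `c_low = ε₀⁻³(O1 + a/(g²ε₀))`, `c_up = O1·ε₀⁻³` — functions of `g`, `ε₀`,
`O1`, `a` only: «uniform in ε bounds for the partition function Z^ε». [cite: Balaban1985UV3, (3) p.256 + (6) p.257] -/
theorem run3_Z_two_sided [RegularGaugeGroup G] (I : RunInput S G) {O1 a : ℝ} (ha : 0 ≤ a)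
    (hreg : ∀ U : GaugeField S.P S.K G, (run3 I).chi S.K U ≠ 0 → (run3 I).mainTerm S.K U ≤ a * S.sites S.K)
    (h5 : B10.Bounds5At (run3 I).toRunData O1 S.K) {δ : ℝ} (h4 : 4 * δ ≤ I.ε₁ S.K) :
    Real.exp (-(S.ε₀⁻¹ ^ 3 * (O1 + a / (S.g ^ 2 * S.ε₀)) * S.volT))
        * (((HaarData.haar : Measure G) {g : G | dist1 g < δ}).toReal) ^ Fintype.card (PBond S.P S.K) ≤ (run3 I).Zeps
      ∧ (run3 I).Zeps ≤ Real.exp (O1 * (S.ε₀⁻¹ ^ 3 * S.volT)) :=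
  ⟨run3_Zeps_ge I (bounds3_of_bounds5At (run3 I) ha hreg h5) h4, run3_Zeps_le I h5⟩

end Summit.QuantumFields.Balaban3D.Proofs.Run3Terminal
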